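import Summits.Ventures.HSemireg.WedgeWeilPuritySchur
import Summits.Ventures.HSemireg.WedgeWeilPurityLocus

/-!
# Venture HSemireg — W-PURITY(ρ), compression (1/2): block forms, the bilinear split of the h-part, the apolar pairing

HONEST FRAMING. Part of the Lean index of the computation cell `pub-hsemireg` (second enclosure wave; this file is seat p6's own
text, gen 8, in the conventions of seat p3's ENCLOSURE-PLAN-p3.md).  Finite-dimensional exterior algebra over a field ONLY:
no variety, no cohomology theory, no semiregularity map is constructed here; nothing here says that HC / HC_CM / HC_AV holds;
no Literature fact is declared or used.  The geometric DICTIONARY (why these ranks are the `HT`-side box ranks of the cell's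
STRUCTURE.md §1 / theory/FORMULA-N.md) lives in theory/FORMULA-N-th7.md PART B §A.3 / §N and is NOT asserted in Lean.

File 1 of 2 of the COMPRESSION of `ψ₋ψ₊ ∣ E₊` (th-7's W-PURITY(ρ), Step 4 second half; the theorem is in
`WedgeWeilPurityCompression.lean`).  In the Weil model of `WedgeWeil*.lean` (`N = n + n` pairs, letters `x_a = X a`, `y_a = Y a`):
* `op s m S = Π_{a<m} (y_{s+a} if a ∈ S else x_{s+a})` (ordered block products in the model's own convention), `Wb s m q = Σ_S q_{|S|} op s m S`
  (`Wb 0 m q = w_m(q)`, `Wb_zero_eq_w`), the recursion `Wb_succ` and the CONCATENATION `Wb_add`;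
* `eps s m j = Σ_{|S| = j} op s m S`, and the BILINEAR SPLIT **`f_eq_sum_eps`**: `w_{2n}(q) = Σ_{j,l ≤ n} q_{j+l} · eps 0 n j · eps n n l`;
* supports: `op 0 m S ∈ Λ^m(V₋) = Hom(Dm) m`, `op n m S ∈ Hom(Gm) m` (`m ≤ n`);
* THE ONE SIGN COMPUTATION **`eps_mul_eps`**: `eps s m j' · eps s m j = [j' + j = m] · (−1)^{C(m,2)+j'} · C(m,j') · Π_{c}(x_c ∧ y_c)`
  (`op_mul_op_compl` by the pair-interleaving induction, `op_mul_op_eq_zero` when a letter is shared), and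
  `Π(x_c∧y_c) = (−1)^{C(n,2)} · E_{Dm}` / `E_{Gm}` (`pp_zero_eq`, `pp_n_eq`, from `WedgeWeilPurityLocus.B_Dm_eq` / `B_Gm_eq`).
Checks at p6 g8 (2026-08-23): tree-prefix chain rc 0 · 0 · 0; negative control NC2 (parity exponent `j' ↦ j` in `eps_mul_eps`) rc 1.
-/

open Module Set Set.powersetCard Summit.Ventures.HSemireg.Wedge.Hankel

namespace Summit.Ventures.HSemireg.Wedge.Weil

variable (K : Type*) [Field K]

section Compression

variable {n : ℕ}

open Summit.Ventures.HSemireg.Wedge.WeilPurity (pp XX YY YX r r_mul_r B_Dm_eq B_Gm_eq)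

/-! ### Ordered block products with prescribed `y`-positions -/

variable (n) in
/-- the ordered block product over the pairs `s, …, s+m−1`, with the letter `y_{s+a}` at the relative positions
`a ∈ S` and `x_{s+a}` elsewhere. -/
noncomputable def op (s m : ℕ) (S : Finset ℕ) : HT K (In (n + n)) :=
  ((List.range m).map fun a => if a ∈ S then Y K (n + n) (s + a) else X K (n + n) (s + a)).prod

variable (n) in
/-- the block generating function with offset `s`: `Wb s m q = Σ_{S ⊆ [0,m)} q_{|S|} · op s m S`
(at `s = 0` this is the model's closed form `G`, i.e. `w_m(q)`). -/
noncomputable def Wb (s m : ℕ) (q : ℕ → K) : HT K (In (n + n)) :=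
  ∑ S ∈ (Finset.range m).powerset, q S.card • op K n s m S

variable (n) in
/-- the degree-`m` «elementary» block form with `j` letters `y`: `eps s m j = Σ_{S ⊆ [0,m), |S| = j} op s m S`. -/
noncomputable def eps (s m j : ℕ) : HT K (In (n + n)) :=
  ∑ S ∈ (Finset.range m).powersetCard j, op K n s m S

/-- the empty block product is `1`. -/
lemma op_zero (s : ℕ) (S : Finset ℕ) : op K n s 0 S = 1 := by
  simp [op]

/-- peeling the last letter off a block product. -/
lemma op_succ (s m : ℕ) (S : Finset ℕ) :
    op K n s (m + 1) S = op K n s m S * (if m ∈ S then Y K (n + n) (s + m) else X K (n + n) (s + m)) := by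
  rw [op, op, List.range_succ, List.map_append, List.prod_append, List.map_singleton, List.prod_singleton]

/-- `Wb 0 m q` is the model's closed form `G_m(q) = w_m(q)`. -/
lemma Wb_zero_eq_w (m : ℕ) (q : ℕ → K) : Wb K n 0 m q = w K (n + n) m q := by
  rw [w_eq_G, Wb, G]
  simp only [op, Nat.zero_add]

/-- the recursion with offset: `Wb s (m+1) q = Wb s m q · x_{s+m} + Wb s m (σq) · y_{s+m}`. -/
lemma Wb_succ (s m : ℕ) (q : ℕ → K) :
    Wb K n s (m + 1) q = Wb K n s m q * X K (n + n) (s + m) + Wb K n s m (shift K q) * Y K (n + n) (s + m) := by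
  have hm : m ∉ Finset.range m := Finset.notMem_range_self
  have hml : m ∉ List.range m := by simp
  have hdisj : Disjoint (Finset.range m).powerset ((Finset.range m).powerset.image (insert m)) := by
    rw [Finset.disjoint_left]
    intro S hS hS'
    obtain ⟨S', -, rfl⟩ := Finset.mem_image.mp hS'
    exact hm (Finset.mem_powerset.mp hS (Finset.mem_insert_self m S'))
  have hinj : Set.InjOn (fun S : Finset ℕ => insert m S) ((Finset.range m).powerset : Set (Finset ℕ)) := by
    intro S hS S' hS' h
    have haS : m ∉ S := fun h' => hm (Finset.mem_powerset.mp (Finset.mem_coe.mp hS) h')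
    have haS' : m ∉ S' := fun h' => hm (Finset.mem_powerset.mp (Finset.mem_coe.mp hS') h')
    have h' : insert m S = insert m S' := h
    rw [← Finset.erase_insert haS, h', Finset.erase_insert haS']
  rw [Wb, Wb, Wb, Finset.range_add_one, Finset.powerset_insert, Finset.sum_union hdisj, Finset.sum_image hinj,
    Finset.sum_mul, Finset.sum_mul]
  congr 1
  · apply Finset.sum_congr rfl
    intro S hS
    have hmS : m ∉ S := fun h' => hm (Finset.mem_powerset.mp hS h')
    rw [op_succ, if_neg hmS, smul_mul_assoc]
  · apply Finset.sum_congr rfl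
    intro S hS
    have hmS : m ∉ S := fun h' => hm (Finset.mem_powerset.mp hS h')
    rw [op_succ, if_pos (Finset.mem_insert_self m S), op, op, prod_map_ite_insert _ _ hml,
      Finset.card_insert_of_notMem hmS, smul_mul_assoc, shift_apply]

omit [Field K] in
/-- iterated shift: `(σ^k q)_t = q_{k+t}`. -/
lemma shift_iterate_apply (k : ℕ) (q : ℕ → K) (t : ℕ) : ((shift K)^[k] q) t = q (k + t) := by
  induction k generalizing t with
  | zero => simp
  | succ k ih => rw [Function.iterate_succ_apply', shift_apply, ih, Nat.add_right_comm, Nat.add_assoc]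

/-- CONCATENATION: `Wb s (m + m') q = Σ_{S ⊆ [0,m)} op s m S · Wb (s+m) m' (σ^{|S|} q)`. -/
lemma Wb_add (s m : ℕ) (q : ℕ → K) : ∀ m' : ℕ,
    Wb K n s (m + m') q = ∑ S ∈ (Finset.range m).powerset, op K n s m S * Wb K n (s + m) m' ((shift K)^[S.card] q)
  | 0 => by
    rw [Nat.add_zero, Wb]
    apply Finset.sum_congr rfl
    intro S _
    rw [Wb, Finset.range_zero, Finset.powerset_empty, Finset.sum_singleton, Finset.card_empty, op_zero,
      shift_iterate_apply, Nat.add_zero, mul_smul_comm, mul_one]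
  | m' + 1 => by
    rw [← Nat.add_assoc, Wb_succ, Wb_add s m q m', Wb_add s m (shift K q) m', Finset.sum_mul, Finset.sum_mul,
      ← Finset.sum_add_distrib]
    apply Finset.sum_congr rfl
    intro S _
    rw [mul_assoc, mul_assoc, ← mul_add, Wb_succ, Nat.add_assoc, ← Function.iterate_succ_apply,
      Function.iterate_succ_apply']

/-- grouping `Wb` by the number of `y`-letters: `Wb s m q = Σ_{j ≤ m} q_j · eps s m j`. -/
lemma Wb_eq_sum_eps (s m : ℕ) (q : ℕ → K) :
    Wb K n s m q = ∑ j ∈ Finset.range (m + 1), q j • eps K n s m j := by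
  rw [Wb, Finset.powerset_card_disjiUnion, Finset.sum_disjiUnion, Finset.card_range]
  apply Finset.sum_congr rfl
  intro j _
  rw [eps, Finset.smul_sum]
  apply Finset.sum_congr rfl
  intro S hS
  rw [(Finset.mem_powersetCard.mp hS).2]

/-- THE BILINEAR SPLIT OF THE h-PART: `f = w_{2n}(q) = Σ_{j ≤ n} Σ_{l ≤ n} q_{j+l} · eps₋ j · eps₊ l`. -/
theorem f_eq_sum_eps (q : ℕ → K) :
    w K (n + n) (n + n) q =
      ∑ j ∈ Finset.range (n + 1), ∑ l ∈ Finset.range (n + 1), q (j + l) • (eps K n 0 n j * eps K n n n l) := by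
  rw [← Wb_zero_eq_w, Wb_add, Finset.powerset_card_disjiUnion, Finset.sum_disjiUnion, Finset.card_range]
  apply Finset.sum_congr rfl
  intro j _
  have h : ∀ S ∈ (Finset.range n).powersetCard j,
      op K n 0 n S * Wb K n (0 + n) n ((shift K)^[S.card] q) =
        ∑ l ∈ Finset.range (n + 1), q (j + l) • (op K n 0 n S * eps K n n n l) := by
    intro S hS
    rw [(Finset.mem_powersetCard.mp hS).2, Nat.zero_add, Wb_eq_sum_eps, Finset.mul_sum]
    apply Finset.sum_congr rfl
    intro l _
    rw [shift_iterate_apply, mul_smul_comm]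
  rw [Finset.sum_congr rfl h, Finset.sum_comm, eps]
  apply Finset.sum_congr rfl
  intro l _
  rw [Finset.sum_mul, Finset.smul_sum]

/-! ### Supports and degrees of the block products -/

/-- `x_a ∈ Λ¹(V₋)` for `a < n`. -/
lemma X_mem_Hom_Dm {a : ℕ} (ha : a < n) : X K (n + n) a ∈ Hom K (In (n + n)) (Dm (n + n) n) 1 := by
  have h : a < n + n := by omega
  rw [X, dif_pos h]
  refine B_mem_Hom K (Finset.singleton_subset_iff.mpr ?_) (Finset.card_singleton _)
  exact mem_Dm_of_not_mem_Gm (fun hh => by rw [xI_mem_Gm_iff] at hh; omega)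

/-- `y_a ∈ Λ¹(V₋)` for `a < n`. -/
lemma Y_mem_Hom_Dm {a : ℕ} (ha : a < n) : Y K (n + n) a ∈ Hom K (In (n + n)) (Dm (n + n) n) 1 := by
  have h : a < n + n := by omega
  rw [Y, dif_pos h]
  refine B_mem_Hom K (Finset.singleton_subset_iff.mpr ?_) (Finset.card_singleton _)
  exact mem_Dm_of_not_mem_Gm (fun hh => by rw [yI_mem_Gm_iff] at hh; omega)

/-- `x_{n+a} ∈ Λ¹(V₊)` for `a < n`. -/
lemma X_mem_Hom_Gm {a : ℕ} (ha : a < n) : X K (n + n) (n + a) ∈ Hom K (In (n + n)) (Gm (n + n) n) 1 := by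
  have h : n + a < n + n := by omega
  rw [X, dif_pos h]
  exact B_mem_Hom K (Finset.singleton_subset_iff.mpr ((xI_mem_Gm_iff h).mpr (by omega))) (Finset.card_singleton _)

/-- `y_{n+a} ∈ Λ¹(V₊)` for `a < n`. -/
lemma Y_mem_Hom_Gm {a : ℕ} (ha : a < n) : Y K (n + n) (n + a) ∈ Hom K (In (n + n)) (Gm (n + n) n) 1 := by
  have h : n + a < n + n := by omega
  rw [Y, dif_pos h]
  exact B_mem_Hom K (Finset.singleton_subset_iff.mpr ((yI_mem_Gm_iff h).mpr (by omega))) (Finset.card_singleton _)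

/-- the lower block products are degree-`m` elements of `Λ(V₋)`. -/
lemma op_mem_Hom_Dm (S : Finset ℕ) : ∀ m : ℕ, m ≤ n → op K n 0 m S ∈ Hom K (In (n + n)) (Dm (n + n) n) m
  | 0, _ => by
    rw [op_zero, ← B_empty]
    exact B_mem_Hom K (Finset.empty_subset _) Finset.card_empty
  | m + 1, hm => by
    rw [op_succ]
    refine mul_mem_Hom K (op_mem_Hom_Dm S m (by omega)) ?_
    split_ifs
    · rw [Nat.zero_add]; exact Y_mem_Hom_Dm K (by omega)
    · rw [Nat.zero_add]; exact X_mem_Hom_Dm K (by omega)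

/-- the upper block products are degree-`m` elements of `Λ(V₊)`. -/
lemma op_mem_Hom_Gm (S : Finset ℕ) : ∀ m : ℕ, m ≤ n → op K n n m S ∈ Hom K (In (n + n)) (Gm (n + n) n) m
  | 0, _ => by
    rw [op_zero, ← B_empty]
    exact B_mem_Hom K (Finset.empty_subset _) Finset.card_empty
  | m + 1, hm => by
    rw [op_succ]
    refine mul_mem_Hom K (op_mem_Hom_Gm S m (by omega)) ?_
    split_ifs
    · exact Y_mem_Hom_Gm K (by omega)
    · exact X_mem_Hom_Gm K (by omega)

/-- `eps₋ j ∈ E₋ = Λⁿ(V₋)`. -/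
lemma eps_mem_Hom_Dm (j : ℕ) : eps K n 0 n j ∈ Hom K (In (n + n)) (Dm (n + n) n) n := by
  rw [eps]
  exact Submodule.sum_mem _ fun S _ => op_mem_Hom_Dm K S n le_rfl

/-- `eps₊ l ∈ E₊ = Λⁿ(V₊)`. -/
lemma eps_mem_Hom_Gm (l : ℕ) : eps K n n n l ∈ Hom K (In (n + n)) (Gm (n + n) n) n := by
  rw [eps]
  exact Submodule.sum_mem _ fun S _ => op_mem_Hom_Gm K S n le_rfl

/-! ### The one sign computation: products of two block products over the same block -/

/-- `x_c` is `ι` of a vector (junk-compatible). -/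
lemma X_eq_ι (c : ℕ) : ∃ v : In (n + n) → K, X K (n + n) c = ExteriorAlgebra.ι K v := by
  by_cases h : c < n + n
  · exact ⟨b K (In (n + n)) (xI c h), by rw [X, dif_pos h, gx_eq_ι]⟩
  · exact ⟨0, by rw [X, dif_neg h, map_zero]⟩

/-- `y_c` is `ι` of a vector (junk-compatible). -/
lemma Y_eq_ι (c : ℕ) : ∃ v : In (n + n) → K, Y K (n + n) c = ExteriorAlgebra.ι K v := by
  by_cases h : c < n + n
  · exact ⟨b K (In (n + n)) (yI c h), by rw [Y, dif_pos h, gx_eq_ι]⟩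
  · exact ⟨0, by rw [Y, dif_neg h, map_zero]⟩

/-- every letter of a block product is `ι` of a vector. -/
lemma letter_eq_ι (S : Finset ℕ) (s a : ℕ) :
    ∃ v : In (n + n) → K, (if a ∈ S then Y K (n + n) (s + a) else X K (n + n) (s + a)) = ExteriorAlgebra.ι K v := by
  split_ifs
  · exact Y_eq_ι K (s + a)
  · exact X_eq_ι K (s + a)

/-- a generator passes a block product of length `m` with the sign `(−1)^m`. -/
lemma ι_mul_op (v : In (n + n) → K) (s : ℕ) (S : Finset ℕ) : ∀ m : ℕ,
    ExteriorAlgebra.ι K v * op K n s m S = ((-1 : K) ^ m) • (op K n s m S * ExteriorAlgebra.ι K v)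
  | 0 => by rw [op_zero, mul_one, one_mul, pow_zero, one_smul]
  | m + 1 => by
    obtain ⟨v', hv'⟩ := letter_eq_ι K S s m
    rw [op_succ, hv', ← mul_assoc, ι_mul_op v s S m, smul_mul_assoc,
      mul_assoc (op K n s m S) (ExteriorAlgebra.ι K v) (ExteriorAlgebra.ι K v'),
      eq_neg_of_add_eq_zero_left (ExteriorAlgebra.ι_add_mul_swap v v'), mul_neg, smul_neg,
      ← mul_assoc (op K n s m S) (ExteriorAlgebra.ι K v') (ExteriorAlgebra.ι K v), pow_succ, mul_neg_one,
      neg_smul]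

/-- one induction step for a product of two block products over the same block. -/
lemma op_succ_mul_op_succ (s m : ℕ) (S S' : Finset ℕ) :
    op K n s (m + 1) S' * op K n s (m + 1) S =
      ((-1 : K) ^ m) • ((op K n s m S' * op K n s m S) *
        ((if m ∈ S' then Y K (n + n) (s + m) else X K (n + n) (s + m)) *
          (if m ∈ S then Y K (n + n) (s + m) else X K (n + n) (s + m)))) := by
  obtain ⟨v', hv'⟩ := letter_eq_ι K S' s m
  rw [op_succ, op_succ, hv', mul_assoc, ← mul_assoc (ExteriorAlgebra.ι K v'), ι_mul_op, smul_mul_assoc,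
    mul_smul_comm, mul_assoc (op K n s m S), ← mul_assoc (op K n s m S')]

/-- two block products sharing a letter multiply to zero. -/
lemma op_mul_op_eq_zero (s : ℕ) (S S' : Finset ℕ) :
    ∀ m : ℕ, (∃ a, a < m ∧ (a ∈ S' ↔ a ∈ S)) → op K n s m S' * op K n s m S = 0
  | 0, ⟨a, ha, _⟩ => absurd ha (Nat.not_lt_zero a)
  | m + 1, ⟨a, ha, haS⟩ => by
    rw [op_succ_mul_op_succ]
    by_cases ham : a = m
    · rw [ham] at haS
      have h0 : (if m ∈ S' then Y K (n + n) (s + m) else X K (n + n) (s + m)) *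
          (if m ∈ S then Y K (n + n) (s + m) else X K (n + n) (s + m)) = 0 := by
        by_cases h : m ∈ S'
        · rw [if_pos h, if_pos (haS.mp h), YY]
        · rw [if_neg h, if_neg (fun h' => h (haS.mpr h')), XX]
      rw [h0, mul_zero, smul_zero]
    · rw [op_mul_op_eq_zero s S S' m ⟨a, by omega, haS⟩, zero_mul, smul_zero]

/-- COMPLEMENTARY block products: `op S' · op S = (−1)^{C(m,2) + |S' ∩ [0,m)|} · Π (x_c ∧ y_c)`. -/
lemma op_mul_op_compl (s : ℕ) (S S' : Finset ℕ) :
    ∀ m : ℕ, (∀ a, a < m → (a ∈ S' ↔ a ∉ S)) →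
      op K n s m S' * op K n s m S = ((-1 : K) ^ (m.choose 2 + (S' ∩ Finset.range m).card)) • pp K n s m
  | 0, _ => by
    rw [op_zero, op_zero, mul_one, Nat.choose_zero_succ, Finset.range_zero, Finset.inter_empty,
      Finset.card_empty, pow_zero, one_smul, pp]
  | m + 1, h => by
    have ih := op_mul_op_compl s S S' m (fun a ha => h a (by omega))
    have hmr : m ∉ S' ∩ Finset.range m := by simp
    have hc : (m + 1).choose 2 = m + m.choose 2 := by
      rw [Nat.choose_succ_succ', Nat.choose_one_right]
    rw [op_succ_mul_op_succ, ih, smul_mul_assoc, smul_smul, ← pow_add, pp, Finset.range_add_one, hc]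
    by_cases hm : m ∈ S'
    · have hmS : m ∉ S := (h m (by omega)).mp hm
      rw [if_pos hm, if_neg hmS, YX, mul_neg, smul_neg, Finset.inter_insert_of_mem hm,
        Finset.card_insert_of_notMem hmr, ← neg_smul, ← mul_neg_one ((-1 : K) ^ _), ← pow_succ]
      congr 2
      omega
    · have hmS : m ∈ S := by
        by_contra hh
        exact hm ((h m (by omega)).mpr hh)
      rw [if_neg hm, if_pos hmS, Finset.inter_insert_of_notMem hm]
      congr 2
      omega

omit [Field K] in
/-- the complement of `S'` in `[0,m)` is complementary to `S'`. -/
lemma compl_cond (m : ℕ) (S' : Finset ℕ) : ∀ a, a < m → (a ∈ S' ↔ a ∉ Finset.range m \ S') := by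
  intro a ha
  rw [Finset.mem_sdiff, Finset.mem_range]
  tauto

omit [Field K] in
/-- any other subset of `[0,m)` shares a letter with `S'`. -/
lemma exists_shared {m : ℕ} {S S' : Finset ℕ} (hS : S ⊆ Finset.range m) (hne : S ≠ Finset.range m \ S') :
    ∃ a, a < m ∧ (a ∈ S' ↔ a ∈ S) := by
  by_contra hcon
  apply hne
  ext a
  rw [Finset.mem_sdiff, Finset.mem_range]
  constructor
  · intro ha
    have ham : a < m := Finset.mem_range.mp (hS ha)
    exact ⟨ham, fun ha' => hcon ⟨a, ham, iff_of_true ha' ha⟩⟩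
  · rintro ⟨ham, haS'⟩
    by_contra haS
    exact hcon ⟨a, ham, iff_of_false haS' haS⟩

/-- **THE APOLAR PAIRING OF THE BLOCK FORMS:** `eps j' · eps j = [j' + j = m] · (−1)^{C(m,2)+j'} · C(m,j') · Π(x_c ∧ y_c)`. -/
theorem eps_mul_eps (s m j' j : ℕ) :
    eps K n s m j' * eps K n s m j =
      (if j' + j = m then ((-1 : K) ^ (m.choose 2 + j')) * (m.choose j' : K) else 0) • pp K n s m := by
  classical
  rw [eps, eps, Finset.sum_mul]
  have hS' : ∀ S' ∈ (Finset.range m).powersetCard j',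
      op K n s m S' * ∑ S ∈ (Finset.range m).powersetCard j, op K n s m S =
        (if j' + j = m then ((-1 : K) ^ (m.choose 2 + j')) else 0) • pp K n s m := by
    intro S' hS'
    obtain ⟨hsub, hcard⟩ := Finset.mem_powersetCard.mp hS'
    have hint : S' ∩ Finset.range m = S' := Finset.inter_eq_left.mpr hsub
    have hj'm : j' ≤ m := by
      have := Finset.card_le_card hsub
      rwa [Finset.card_range, hcard] at this
    rw [Finset.mul_sum]
    by_cases hj : j' + j = m
    · rw [if_pos hj]
      have hmem : Finset.range m \ S' ∈ (Finset.range m).powersetCard j := by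
        rw [Finset.mem_powersetCard]
        refine ⟨Finset.sdiff_subset, ?_⟩
        rw [Finset.card_sdiff_of_subset hsub, Finset.card_range, hcard]
        omega
      rw [Finset.sum_eq_single (Finset.range m \ S')]
      · rw [op_mul_op_compl K s _ S' m (compl_cond m S'), hint, hcard]
      · intro S hS hne
        exact op_mul_op_eq_zero K s S S' m (exists_shared (Finset.mem_powersetCard.mp hS).1 hne)
      · intro h; exact absurd hmem h
    · rw [if_neg hj, zero_smul]
      apply Finset.sum_eq_zero
      intro S hS
      obtain ⟨hSsub, hScard⟩ := Finset.mem_powersetCard.mp hS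
      apply op_mul_op_eq_zero K s S S' m (exists_shared hSsub ?_)
      intro heq
      apply hj
      rw [heq, Finset.card_sdiff_of_subset hsub, Finset.card_range, hcard] at hScard
      omega
  rw [Finset.sum_congr rfl hS', Finset.sum_const, Finset.card_powersetCard, Finset.card_range, ← Nat.cast_smul_eq_nsmul K,
    smul_smul]
  congr 1
  split_ifs
  · ring
  · rw [mul_zero]

/-- `Π(x_c ∧ y_c)` over the lower block is `(−1)^{C(n,2)} · E_{Dm}`. -/
lemma pp_zero_eq : pp K n 0 n = r K n • B K (In (n + n)) (Dm (n + n) n) := by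
  rw [B_Dm_eq, smul_smul, r_mul_r, one_smul]

/-- `Π(x_c ∧ y_c)` over the upper block is `(−1)^{C(n,2)} · E_{Gm}`. -/
lemma pp_n_eq : pp K n n n = r K n • B K (In (n + n)) (Gm (n + n) n) := by
  rw [B_Gm_eq, smul_smul, r_mul_r, one_smul]

end Compression

end Summit.Ventures.HSemireg.Wedge.Weil
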